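import Mathlib
import Literature.Geometry.Symplectic.PositivityOfIntersectionsLocal
import Literature.Geometry.Symplectic.JHolomorphicSheetChartInverse
import Literature.Geometry.Symplectic.JHolomorphicSheetDbarLocal
import Literature.Analysis.Complex.SimilarityPrinciple
import Literature.Analysis.Complex.SimilarityPrincipleLocal
import Literature.Analysis.Complex.ArgumentPrincipleWinding
import HarnessLib

/-!
# Positivity of intersections with a leaf coordinate — proof of the named fact

This file DISCHARGES the named fact
`Literature.Geometry.Symplectic.positivityOfIntersections_leafCoordinate`
(`Literature/Geometry/Symplectic/PositivityOfIntersectionsLocal.lean`; Wendl (2018), §2.2.2, the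
local statement preceding Thm. 2.49; McDuff (1991), Thm. 1.1; Micallef–White (1995), Thm. 7.1):
`theorem positivityOfIntersections_leafCoordinate_holds`.

## The printed proof and how it is followed

The case at hand is the "easy case" of positivity of intersections in which one of the two
branches (the leaf `w`) is IMMERSED (McDuff (1991), §5, case (i) of (5.1); Wendl (2020), App. B,
Thm. B.20 / Cor. B.21 and §B.2; McDuff–Salamon (2012), §2.4 and App. E.2): choose coordinates near the
intersection point in which the immersed branch is an axis and `J` is standard along it; the normal
component `c` of the second curve then satisfies a linear inequality `|∂̄ c| ≤ M |c|`, so by the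
Carleman similarity principle `c = Φ h` with `h` holomorphic — either `c ≡ 0` near the point (the
second curve lies in the leaf) or the zero is isolated of positive index, equal to `1` exactly when
the intersection is transverse. The tree already holds the two analytic engines of this argument as
PROVED theorems, and they are reused verbatim:

* the sheet chart, its inverse-function package and the scalar reduction `‖∂̄ c‖ ≤ M ‖c‖`
  (`Literature/Geometry/Symplectic/JHolomorphicSheetChart*.lean`, `…SheetDbar*.lean`,
  flat, in a `4`-dimensional real normed space);
* the similarity principle in comparison form, `e^{-S} |c| ≤ |H| ≤ e^{S} |c|` with `H` holomorphic
  and equal winding numbers (`Literature/Analysis/Complex/SimilarityPrinciple*.lean`), and the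
  argument principle for `H` (`Literature/Analysis/Complex/ArgumentPrincipleWinding.lean`).

What is added here (namespace `Literature.Geometry.Symplectic.LeafPositivity`):

1. `exists_local_comparison`, `index_of_comparison` — from the comparison function: `0` is an
   isolated zero of `c`, `wind (c ∘ ∂B(0,r)) = k := ord₀ H ≥ 1` for all small `r`, and
   `k = 1 ↔ dc_0 ≠ 0` (growth of `|c| ≍ |H| = |z|^k |g|` at the zero; `dc_0` is complex-linear
   because `∂̄ c (0) = 0`).
2. `flat_leaf_dichotomy` — the flat core: the LEAF FUNCTION `A` (vanishing along the sheet, `dA`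
   surjective and `J`-complex-linear at the point) is compared with the normal coordinate `c` of the
   sheet chart: `A ∘ E (α, γ) = λ γ + o(γ)` with `λ ≠ 0` (`ker dA = im db` by a dimension count,
   complex-linearity of the sheet chart along the axis), hence `|A ∘ v - λ c| ≤ (|λ|/2) |c|` along
   the curve, so `A ∘ v` and `c` have the same zeros and (Rouché for loops) the same winding numbers,
   and `d(A ∘ v)_0 = λ · dc_0`.
3. `exists_flatJ` and the final assembly — transport from the manifold `X` (charted on `ℝ⁴`) to the
   flat setting: the almost complex structure read in the trivialisation of `End(TX)` at the point
   (`Bundle.Trivialization.contMDiffOn_section_baseSet_iff`,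
   `TangentBundle.continuousLinearMapAt_trivializationAt`) and cut off by a bump function, the two
   curves read in the extended chart (made globally smooth by a reparametrisation `σ` that is the
   identity near `0`), the Cauchy–Riemann equations in the chart
   (`mfderivWithin_extChartAt_symm_comp_mfderiv_extChartAt'`), and the leaf function `a ∘ φ⁻¹`.

Nothing new is asserted: no `def`, no named fact; the statement proved is the tree's, byte for byte.

## References

* C. Wendl, *Holomorphic Curves in Low Dimensions*, LNM 2216 (2018), §2.2.2 (p. 62, local
  positivity of intersections), Thm. 2.49. [Wendl2018]
* D. McDuff, *The local behaviour of holomorphic curves in almost complex 4-manifolds*, J. Diff.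
  Geom. 34 (1991), Thm. 1.1, Lemma 2.5, §5 (5.1). [McDuff1991LocalBehaviour]
* M. Micallef, B. White, Ann. of Math. 141 (1995), Thm. 7.1. [MicallefWhite1995]
* C. Wendl, *Lectures on Contact 3-Manifolds, Holomorphic Curves and Intersection Theory* (2020),
  App. B, Thm. B.20, Cor. B.21. [Wendl2020]
* D. McDuff, D. Salamon, *J-holomorphic curves and symplectic topology*, 2nd ed. (2012), §2.4,
  App. E. [McDuffSalamon2012]
-/

noncomputable section

open scoped ContDiff Topology Manifold
open Filter Set Metric Function Bundle
open Literature.Topology.PlaneTopology Literature.Analysis.Complex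

namespace Literature.Geometry.Symplectic

namespace LeafPositivity

/-! ### The index at a zero from the holomorphic comparison function -/

/-- Multiplying a nonvanishing loop by a nonzero constant does not change its winding number.
[folklore] -/
theorem wind_const_mul {f : ℝ → ℂ} (hf : IsNonvanishingLoop f) {c : ℂ} (hc : c ≠ 0) :
    wind (fun t => c * f t) = wind f := by
  rw [wind_mul (IsNonvanishingLoop.const hc) hf, wind_const, zero_add]

/-- **Similarity comparison at a zero, local form.** Let `c` be smooth on `B(0, 2ρ)` with
`‖∂̄ c‖ ≤ M ‖c‖` on `B̄(0, ρ)`. Then there are `S`, `ρ' > 0` and `H` holomorphic on `B(0, ρ')` with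
`e^{-S} ‖c z‖ ≤ ‖H z‖ ≤ e^{S} ‖c z‖` for `‖z‖ < ρ'`, and `wind (c ∘ γ) = wind (H ∘ γ)` along every
circle `γ : ‖z‖ = ε`, `ε < ρ'`, on which `c` has no zero.
[cite: Wendl2020, App. B Thm B.20 and Cor B.21 (similarity principle)] -/
theorem exists_local_comparison (c : ℂ → ℂ) (ρ M : ℝ) (hρ : 0 < ρ)
    (hc : ContDiffOn ℝ ∞ c (ball 0 (2 * ρ)))
    (hbound : ∀ ζ ∈ closedBall (0 : ℂ) ρ, ‖dbarAlong 1 c ζ‖ ≤ M * ‖c ζ‖) :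
    ∃ (S ρ' : ℝ) (H : ℂ → ℂ), 0 < ρ' ∧ ρ' < ρ ∧ DifferentiableOn ℂ H (ball 0 ρ') ∧
      (∀ z : ℂ, ‖z‖ < ρ' → Real.exp (-S) * ‖c z‖ ≤ ‖H z‖ ∧ ‖H z‖ ≤ Real.exp S * ‖c z‖) ∧
      ∀ ε : ℝ, 0 < ε → ε < ρ' → (∀ z : ℂ, ‖z‖ = ε → c z ≠ 0) →
        wind (fun t => c (circleLoop 0 ε t)) = wind (fun t => H (circleLoop 0 ε t)) := by
  -- the cut-off and the localised function `w = χ · c`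
  obtain ⟨χ, hχ, -, hχ1, hχ0, -⟩ :=
    Similarity.exists_cutoff (ρm := 3 * ρ / 4) (ρ := ρ) (by linarith) (by linarith)
  set w : ℂ → ℂ := fun z => χ z * c (0 + z) with hw_def
  have hw : ContDiff ℝ ∞ w := Similarity.contDiff_cutoff_mul hρ hχ hχ0 (by simpa using hc)
  have hwc : ∀ z : ℂ, ‖z‖ ≤ 3 * ρ / 4 → w z = c z := fun z hz => by
    simp only [hw_def, hχ1 z hz, one_mul, zero_add]
  have hgerm : ∀ η : ℂ, ‖η‖ < 3 * ρ / 4 → w =ᶠ[𝓝 η] fun z => c (0 + z) := fun η hη => by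
    filter_upwards [isOpen_ball.mem_nhds (mem_ball_zero_iff.2 hη)] with z hz
    rw [zero_add]
    exact hwc z (le_of_lt (mem_ball_zero_iff.1 hz))
  have hbound' : ∀ η : ℂ, ‖η‖ ≤ ρ / 2 → ‖dbarAlong 1 w η‖ ≤ M * ‖w η‖ := by
    intro η hη
    rw [Similarity.dbarAlong_one_eq_of_eventuallyEq_translate (hgerm η (by linarith)),
      hwc η (by linarith), zero_add]
    exact hbound η (mem_closedBall_zero_iff.2 (by linarith))
  have hdw : ContDiff ℝ ∞ (dbarAlong 1 w) := contDiff_infty_dbarAlong hw 1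
  obtain ⟨S, H, hH, hcomp, hwind⟩ := similarity_comparison w (dbarAlong 1 w) M (ρ / 2) (ρ / 4)
    (by linarith) (by linarith) hw hdw (fun _ => rfl) hbound'
  refine ⟨S, ρ / 4, H, by linarith, by linarith, hH, fun z hz => ?_, fun ε hε hερ hne => ?_⟩
  · have h := hcomp z hz
    rwa [hwc z (by linarith)] at h
  · have h := hwind 0 ε hε (by rw [norm_zero, zero_add]; exact hερ) fun z hz => by
      rw [sub_zero] at hz
      rw [hwc z (by rw [hz]; linarith)]
      exact hne z hz
    rw [← h]
    refine wind_congr fun t _ => ?_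
    have hn : ‖circleLoop 0 ε t‖ = ε := by
      simpa [abs_of_pos hε] using norm_circleLoop_sub_center 0 ε t
    exact (hwc _ (by rw [hn]; linarith)).symm

/-- If `∂̄ c (0) = 0` then `dc_0` is complex-linear: `dc_0 ζ = ζ · dc_0 1`.
[folklore] -/
theorem fderiv_apply_eq_mul_of_dbar_zero {c : ℂ → ℂ} (h : dbarAlong 1 c 0 = 0) (ζ : ℂ) :
    fderiv ℝ c 0 ζ = ζ * fderiv ℝ c 0 1 := by
  set D := fderiv ℝ c 0 with hD
  have h1 : D 1 + Complex.I * D Complex.I = 0 := by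
    have h' := h
    rw [dbarAlong_one] at h'
    simpa [smul_eq_mul] using h'
  have hI : D Complex.I = Complex.I * D 1 := by
    have h2 : Complex.I * (D 1 + Complex.I * D Complex.I) = 0 := by rw [h1, mul_zero]
    have h3 : Complex.I * D 1 - D Complex.I = 0 := by
      have : Complex.I * (D 1 + Complex.I * D Complex.I) =
          Complex.I * D 1 + Complex.I * Complex.I * D Complex.I := by ring
      rw [this, Complex.I_mul_I] at h2
      linear_combination h2
    exact (sub_eq_zero.1 h3).symm
  have hdec : ζ = (ζ.re : ℂ) + (ζ.im : ℂ) * Complex.I := (Complex.re_add_im ζ).symm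
  calc D ζ = D ((ζ.re : ℝ) • (1 : ℂ) + (ζ.im : ℝ) • Complex.I) := by
        rw [Complex.real_smul, Complex.real_smul, mul_one, Complex.re_add_im]
    _ = (ζ.re : ℝ) • D 1 + (ζ.im : ℝ) • D Complex.I := by rw [map_add, map_smul, map_smul]
    _ = ζ * D 1 := by
        rw [hI, Complex.real_smul, Complex.real_smul]
        conv_rhs => rw [hdec]
        ring

/-- Lower growth at a nondegenerate zero: if `c 0 = 0` and `dc_0 ζ = ζ μ` with `μ ≠ 0`, then
`‖c z‖ ≥ (‖μ‖/2) ‖z‖` near `0`.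
[folklore] -/
theorem eventually_norm_ge_of_fderiv {c : ℂ → ℂ} (hd : DifferentiableAt ℝ c 0) (h0 : c 0 = 0)
    {μ : ℂ} (hμ : ∀ ζ : ℂ, fderiv ℝ c 0 ζ = ζ * μ) :
    ∀ᶠ z in 𝓝 (0 : ℂ), ‖μ‖ / 2 * ‖z‖ ≤ ‖c z‖ := by
  have hlo := hd.hasFDerivAt.isLittleO
  rw [Asymptotics.isLittleO_iff] at hlo
  by_cases hμ0 : μ = 0
  · filter_upwards with z
    rw [hμ0, norm_zero, zero_div, zero_mul]; exact norm_nonneg _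
  have hpos : 0 < ‖μ‖ / 2 := by positivity
  filter_upwards [hlo hpos] with z hz
  rw [h0, sub_zero, sub_zero, hμ] at hz
  -- `‖c z - z μ‖ ≤ ‖μ‖/2 ‖z‖` forces `‖c z‖ ≥ ‖z μ‖ - ‖μ‖/2 ‖z‖`
  have h1 : ‖z * μ‖ = ‖μ‖ * ‖z‖ := by rw [norm_mul, mul_comm]
  have h2 : ‖z * μ‖ - ‖c z‖ ≤ ‖c z - z * μ‖ := by
    rw [← norm_neg (c z - z * μ), neg_sub]; exact norm_sub_norm_le _ _
  linarith

/-- Upper growth at a degenerate zero: if `c` is `C^∞` near `0`, `c 0 = 0` and `dc_0 = 0`, then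
`‖c z‖ ≤ C ‖z‖²` near `0`.
[folklore] -/
theorem eventually_norm_le_sq_of_fderiv_eq_zero {c : ℂ → ℂ} {ρ₁ : ℝ} (hρ₁ : 0 < ρ₁)
    (hc : ContDiffOn ℝ ∞ c (ball 0 ρ₁)) (h0 : c 0 = 0) (hD : fderiv ℝ c 0 = 0) :
    ∃ C : ℝ, ∀ᶠ z in 𝓝 (0 : ℂ), ‖c z‖ ≤ C * ‖z‖ ^ 2 := by
  -- `fderiv c` is differentiable at `0`
  have hc1 : ContDiffOn ℝ 1 (fderiv ℝ c) (ball 0 ρ₁) :=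
    ((contDiffOn_succ_iff_fderiv_of_isOpen isOpen_ball).1 (hc.of_le (by norm_cast))).2.2
      |>.of_le le_rfl
  have hdiff : DifferentiableAt ℝ (fderiv ℝ c) 0 :=
    (hc1.differentiableOn one_ne_zero).differentiableAt (ball_mem_nhds 0 hρ₁)
  set D2 := fderiv ℝ (fderiv ℝ c) 0 with hD2
  have hlo := hdiff.hasFDerivAt.isLittleO
  rw [Asymptotics.isLittleO_iff] at hlo
  have hev1 : ∀ᶠ z in 𝓝 (0 : ℂ), ‖fderiv ℝ c z‖ ≤ (‖D2‖ + 1) * ‖z‖ := by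
    filter_upwards [hlo one_pos] with z hz
    rw [hD, sub_zero, sub_zero, one_mul] at hz
    calc ‖fderiv ℝ c z‖ = ‖(fderiv ℝ c z - D2 z) + D2 z‖ := by rw [sub_add_cancel]
      _ ≤ ‖fderiv ℝ c z - D2 z‖ + ‖D2 z‖ := norm_add_le _ _
      _ ≤ ‖z‖ + ‖D2‖ * ‖z‖ := add_le_add hz (D2.le_opNorm z)
      _ = (‖D2‖ + 1) * ‖z‖ := by ring
  have hcd : ∀ᶠ z in 𝓝 (0 : ℂ), DifferentiableAt ℝ c z := by
    filter_upwards [ball_mem_nhds (0 : ℂ) hρ₁] with z hz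
    exact (hc.differentiableOn (by simp)).differentiableAt (isOpen_ball.mem_nhds hz)
  obtain ⟨δ, hδ, hball⟩ := Metric.eventually_nhds_iff_ball.1 (hev1.and hcd)
  refine ⟨‖D2‖ + 1, ?_⟩
  filter_upwards [ball_mem_nhds (0 : ℂ) hδ] with z hz
  -- mean value inequality on the closed ball of radius `‖z‖`
  have hsub : closedBall (0 : ℂ) ‖z‖ ⊆ ball 0 δ :=
    closedBall_subset_ball (mem_ball_zero_iff.1 hz)
  have key := Convex.norm_image_sub_le_of_norm_fderiv_le (𝕜 := ℝ) (f := c)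
    (s := closedBall (0 : ℂ) ‖z‖) (C := (‖D2‖ + 1) * ‖z‖) (x := 0) (y := z)
    (fun x hx => (hball x (hsub hx)).2)
    (fun x hx => ((hball x (hsub hx)).1).trans (by
      have := mem_closedBall_zero_iff.1 hx
      have h' : 0 ≤ ‖D2‖ + 1 := by positivity
      nlinarith))
    (convex_closedBall 0 ‖z‖) (mem_closedBall_self (norm_nonneg z))
    (mem_closedBall_zero_iff.2 le_rfl)
  rw [h0, sub_zero, sub_zero] at key
  nlinarith [key]

/-- **Index at an isolated zero from the holomorphic comparison function.** Let `c` be smooth near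
`0` with `c 0 = 0`, `∂̄ c (0) = 0`, not identically zero near `0`, and let `H` be holomorphic on
`B(0, ρ')` with `e^{-S} ‖c‖ ≤ ‖H‖ ≤ e^{S} ‖c‖` and the same winding numbers as `c` along zero-free
circles. Then `0` is an isolated zero of `c`, the winding number of `c` along every small circle
about `0` is the order `k ≥ 1` of `H` at `0`, and `k = 1` iff `dc_0 ≠ 0`.
[cite: Wendl2020, App. B Thm B.20 and Cor B.21 (similarity principle)] -/
theorem index_of_comparison {c H : ℂ → ℂ} {ρ₁ ρ' S : ℝ} (hρ₁ : 0 < ρ₁) (hρ' : 0 < ρ')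
    (hc : ContDiffOn ℝ ∞ c (ball 0 ρ₁)) (h0 : c 0 = 0) (hdbar0 : dbarAlong 1 c 0 = 0)
    (hH : DifferentiableOn ℂ H (ball 0 ρ'))
    (hcomp : ∀ z : ℂ, ‖z‖ < ρ' → Real.exp (-S) * ‖c z‖ ≤ ‖H z‖ ∧ ‖H z‖ ≤ Real.exp S * ‖c z‖)
    (hwind : ∀ ε : ℝ, 0 < ε → ε < ρ' → (∀ z : ℂ, ‖z‖ = ε → c z ≠ 0) →
        wind (fun t => c (circleLoop 0 ε t)) = wind (fun t => H (circleLoop 0 ε t)))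
    (hne : ∃ᶠ z in 𝓝 (0 : ℂ), c z ≠ 0) :
    ∃ r₀ : ℝ, 0 < r₀ ∧ (∀ z : ℂ, 0 < ‖z‖ → ‖z‖ ≤ r₀ → c z ≠ 0) ∧
      ∃ k : ℕ, 1 ≤ k ∧ (∀ r : ℝ, 0 < r → r ≤ r₀ → wind (fun t => c (circleLoop 0 r t)) = k) ∧
        (k = 1 ↔ fderiv ℝ c 0 ≠ 0) := by
  classical
  have hHa : AnalyticAt ℂ H 0 := hH.analyticAt (ball_mem_nhds 0 hρ')
  have hH0 : H 0 = 0 := by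
    have h := (hcomp 0 (by simpa using hρ')).2
    rw [h0, norm_zero, mul_zero] at h
    exact norm_le_zero_iff.1 h
  -- `H` is not identically zero near `0` (else `c` would be)
  have hHne : ¬ (∀ᶠ z in 𝓝 (0 : ℂ), H z = 0) := by
    intro hev
    apply hne
    filter_upwards [hev, ball_mem_nhds (0 : ℂ) hρ'] with z hz hz'
    have h := (hcomp z (mem_ball_zero_iff.1 hz')).1
    rw [hz, norm_zero] at h
    have h' : ‖c z‖ ≤ 0 := by
      by_contra hlt
      push Not at hlt
      have := mul_pos (Real.exp_pos (-S)) hlt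
      linarith
    exact not_not.2 (norm_le_zero_iff.1 h')
  -- factorisation `H z = z ^ k • g z` with `g 0 ≠ 0`, `k ≥ 1`
  have hord : analyticOrderAt H 0 ≠ ⊤ := fun h => hHne (analyticOrderAt_eq_top.1 h)
  obtain ⟨g, hg, hg0, hfac⟩ := hHa.analyticOrderAt_ne_top.1 hord
  set k : ℕ := analyticOrderNatAt H 0 with hk_def
  have hk : 1 ≤ k := by
    by_contra hlt
    have hk0 : k = 0 := by omega
    have h := hfac.self_of_nhds
    simp only [hk0, pow_zero, one_smul] at h
    exact hg0 (h ▸ hH0)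
  -- a ball on which the factorisation holds and `g` is continuous and zero-free
  have hgne : ∀ᶠ z in 𝓝 (0 : ℂ), g z ≠ 0 := hg.continuousAt.eventually_ne hg0
  have hgcont : ∀ᶠ z in 𝓝 (0 : ℂ), ContinuousAt g z :=
    hg.eventually_analyticAt.mono fun z hz => hz.continuousAt
  obtain ⟨δ, hδ, hballδ⟩ := Metric.eventually_nhds_iff_ball.1 (hfac.and (hgne.and hgcont))
  set r₀ : ℝ := min δ ρ' / 2 with hr₀_def
  have hr₀ : 0 < r₀ := by
    have := lt_min hδ hρ'
    positivity
  have hr₀δ : r₀ < δ := by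
    have := min_le_left δ ρ'
    rw [hr₀_def]; linarith [lt_min hδ hρ']
  have hr₀ρ : r₀ < ρ' := by
    have := min_le_right δ ρ'
    rw [hr₀_def]; linarith [lt_min hδ hρ']
  have hfacz : ∀ z : ℂ, ‖z‖ < δ → H z = z ^ k * g z := fun z hz => by
    have h := (hballδ z (mem_ball_zero_iff.2 hz)).1
    simpa only [sub_zero, smul_eq_mul] using h
  have hHz : ∀ z : ℂ, 0 < ‖z‖ → ‖z‖ < δ → H z ≠ 0 := fun z hz hzδ => by
    rw [hfacz z hzδ]
    exact mul_ne_zero (pow_ne_zero _ (norm_pos_iff.1 hz)) (hballδ z (mem_ball_zero_iff.2 hzδ)).2.1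
  have hcz : ∀ z : ℂ, 0 < ‖z‖ → ‖z‖ ≤ r₀ → c z ≠ 0 := fun z hz hzr hc0 => by
    have h := (hcomp z (by linarith)).2
    rw [hc0, norm_zero, mul_zero] at h
    exact hHz z hz (by linarith) (norm_le_zero_iff.1 h)
  refine ⟨r₀, hr₀, hcz, k, hk, fun r hr hrr₀ => ?_, ?_⟩
  · -- the winding number along `‖z‖ = r` is `k`
    rw [hwind r hr (by linarith) fun z hz => hcz z (by rw [hz]; exact hr) (by rw [hz]; exact hrr₀)]
    have hrδ : r < δ := by linarith
    have hsum := ArgPrinciple.wind_eq_sum (H := H) (g := g) hr {0} (fun _ => k)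
      (fun u hu => by rw [Finset.mem_singleton.1 hu, norm_zero]; exact hr)
      (fun z hz => ((hballδ z (closedBall_subset_ball hrδ hz)).2.2).continuousWithinAt)
      (fun z hz => (hballδ z (closedBall_subset_ball hrδ hz)).2.1)
      (fun z hz => by
        rw [Finset.prod_singleton, sub_zero]
        exact hfacz z (mem_ball_zero_iff.1 (closedBall_subset_ball hrδ hz)))
    rw [hsum, Finset.sum_singleton]
  · -- `k = 1 ↔ dc_0 ≠ 0`
    -- a bound for `g` near `0`
    have hgbd : ∀ᶠ z in 𝓝 (0 : ℂ), ‖g z‖ ≤ ‖g 0‖ + 1 := by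
      have h := hg.continuousAt.norm
      filter_upwards [Metric.tendsto_nhds.1 h 1 one_pos] with z hz
      rw [Real.dist_eq] at hz
      have := abs_lt.1 hz
      linarith
    have hneBot : (𝓝[≠] (0 : ℂ)).NeBot := inferInstance
    have htends0 : ∀ K : ℝ, Tendsto (fun z : ℂ => K * ‖z‖) (𝓝[≠] (0 : ℂ)) (𝓝 0) := fun K => by
      have h : Tendsto (fun z : ℂ => K * ‖z‖) (𝓝 (0 : ℂ)) (𝓝 (K * ‖(0 : ℂ)‖)) :=
        (continuous_const.mul continuous_norm).continuousAt
      rw [norm_zero, mul_zero] at h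
      exact h.mono_left nhdsWithin_le_nhds
    constructor
    · intro hk1 hD
      -- degenerate zero: `‖c z‖ ≤ C ‖z‖²`, so `‖g z‖ ≤ e^S C ‖z‖`, forcing `g 0 = 0`
      obtain ⟨C, hC⟩ := eventually_norm_le_sq_of_fderiv_eq_zero hρ₁ hc h0 hD
      have hgz : ∀ᶠ z in 𝓝[≠] (0 : ℂ), ‖g z‖ ≤ Real.exp S * C * ‖z‖ := by
        have h1 : ∀ᶠ z in 𝓝[≠] (0 : ℂ), z ≠ 0 := self_mem_nhdsWithin
        filter_upwards [h1, nhdsWithin_le_nhds hC, nhdsWithin_le_nhds (ball_mem_nhds (0 : ℂ) hδ),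
          nhdsWithin_le_nhds (ball_mem_nhds (0 : ℂ) hρ')] with z hz hCz hzδ hzρ
        have hzδ' := mem_ball_zero_iff.1 hzδ
        have h2 := (hcomp z (mem_ball_zero_iff.1 hzρ)).2
        rw [hfacz z hzδ', hk1, pow_one, norm_mul] at h2
        have hzpos : 0 < ‖z‖ := norm_pos_iff.2 hz
        have h3 : ‖z‖ * ‖g z‖ ≤ ‖z‖ * (Real.exp S * C * ‖z‖) := by
          calc ‖z‖ * ‖g z‖ ≤ Real.exp S * ‖c z‖ := h2
            _ ≤ Real.exp S * (C * ‖z‖ ^ 2) := by gcongr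
            _ = ‖z‖ * (Real.exp S * C * ‖z‖) := by ring
        exact le_of_mul_le_mul_left h3 hzpos
      have hlim : ‖g 0‖ ≤ 0 :=
        le_of_tendsto_of_tendsto (hg.continuousAt.norm.mono_left nhdsWithin_le_nhds)
          (htends0 (Real.exp S * C)) hgz
      exact hg0 (norm_le_zero_iff.1 hlim)
    · intro hD
      -- nondegenerate zero: `dc_0 ζ = ζ μ`, `μ ≠ 0`, so `‖H z‖ ≥ e^{-S} ‖μ‖/2 ‖z‖`; then `k ≤ 1`
      set μ : ℂ := fderiv ℝ c 0 1 with hμ_def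
      have hμ : ∀ ζ : ℂ, fderiv ℝ c 0 ζ = ζ * μ := fderiv_apply_eq_mul_of_dbar_zero hdbar0
      have hμ0 : μ ≠ 0 := fun hμ0 => hD (ContinuousLinearMap.ext fun ζ => by
        rw [hμ ζ, hμ0, mul_zero]; rfl)
      have hdiff : DifferentiableAt ℝ c 0 :=
        (hc.differentiableOn (by simp)).differentiableAt (ball_mem_nhds 0 hρ₁)
      have hlow := eventually_norm_ge_of_fderiv hdiff h0 hμ
      by_contra hk1
      have hk2 : 2 ≤ k := by omega
      set a : ℝ := Real.exp (-S) * (‖μ‖ / 2) with ha_def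
      have ha : 0 < a := by positivity
      have hev : ∀ᶠ z in 𝓝[≠] (0 : ℂ), a ≤ (‖g 0‖ + 1) * ‖z‖ := by
        have h1 : ∀ᶠ z in 𝓝[≠] (0 : ℂ), z ≠ 0 := self_mem_nhdsWithin
        filter_upwards [h1, nhdsWithin_le_nhds hlow, nhdsWithin_le_nhds hgbd,
          nhdsWithin_le_nhds (ball_mem_nhds (0 : ℂ) hδ),
          nhdsWithin_le_nhds (ball_mem_nhds (0 : ℂ) (lt_min hρ' one_pos))] with z hz hlz hgz hzδ hz1
        have hzδ' := mem_ball_zero_iff.1 hzδ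
        have hz1' := mem_ball_zero_iff.1 hz1
        have hzρ : ‖z‖ < ρ' := lt_of_lt_of_le hz1' (min_le_left _ _)
        have hzone : ‖z‖ < 1 := lt_of_lt_of_le hz1' (min_le_right _ _)
        have hzpos : 0 < ‖z‖ := norm_pos_iff.2 hz
        have h2 := (hcomp z hzρ).1
        rw [hfacz z hzδ', norm_mul, norm_pow] at h2
        -- `e^{-S} ‖μ‖/2 ‖z‖ ≤ e^{-S} ‖c z‖ ≤ ‖z‖^k ‖g z‖ ≤ ‖z‖² (‖g 0‖ + 1)`
        have h3 : ‖z‖ ^ k ≤ ‖z‖ ^ 2 := pow_le_pow_of_le_one hzpos.le hzone.le hk2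
        have h4 : a * ‖z‖ ≤ ‖z‖ * ((‖g 0‖ + 1) * ‖z‖) := by
          calc a * ‖z‖ = Real.exp (-S) * (‖μ‖ / 2 * ‖z‖) := by rw [ha_def]; ring
            _ ≤ Real.exp (-S) * ‖c z‖ := by gcongr
            _ ≤ ‖z‖ ^ k * ‖g z‖ := h2
            _ ≤ ‖z‖ ^ 2 * (‖g 0‖ + 1) := by gcongr
            _ = ‖z‖ * ((‖g 0‖ + 1) * ‖z‖) := by ring
        rw [mul_comm a] at h4
        exact le_of_mul_le_mul_left h4 hzpos
      have hlim : a ≤ 0 := le_of_tendsto_of_tendsto tendsto_const_nhds (htends0 _) hev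
      linarith

/-! ### The flat core: a `J`-curve against an immersed `J`-sheet, read through a leaf function -/

variable {F : Type*} [NormedAddCommGroup F] [NormedSpace ℝ F]

/-- A real-linear endomorphism of `ℂ` commuting with `i` is multiplication by a complex number.
[folklore] -/
theorem apply_eq_mul_of_map_I_mul (L : ℂ →L[ℝ] ℂ) (h : ∀ γ : ℂ, L (Complex.I * γ) = Complex.I * L γ)
    (γ : ℂ) : L γ = γ * L 1 := by
  have hI : L Complex.I = Complex.I * L 1 := by simpa using h 1
  calc L γ = L ((γ.re : ℝ) • (1 : ℂ) + (γ.im : ℝ) • Complex.I) := by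
        rw [Complex.real_smul, Complex.real_smul, mul_one, Complex.re_add_im]
    _ = (γ.re : ℝ) • L 1 + (γ.im : ℝ) • L Complex.I := by rw [map_add, map_smul, map_smul]
    _ = γ * L 1 := by
        rw [hI, Complex.real_smul, Complex.real_smul]
        conv_rhs => rw [← Complex.re_add_im γ]
        ring

/-- **The sheet package at a common point.** For `dim F = 4`, `J` smooth, `b` a smooth sheet,
`J`-holomorphic on `B(0, R₁)` with `J² = -1` along it and immersed at `0`, and `v` smooth,
`J`-holomorphic on `B(0, R₂)` with `v 0 = b 0`: a sheet chart `e = sheetChart J b ν₀` (local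
diffeomorphism at `(0,0)` with smooth inverse and injective differential at `(0,0)`), a radius `ρ₁`
with `v (B(0, ρ₁)) ⊆ e.target`, the coordinates `(α, c) = e.symm ∘ v` smooth on `B(0, ρ₁)` with
`(α 0, c 0) = (0, 0)`, and the inequality `‖∂̄ c‖ ≤ M ‖c‖` on a closed disc `B̄(0, ρ)`, `ρ < ρ₁`.
[cite: McDuff1991LocalBehaviour, Lemma 2.5 and §5 (5.1)] -/
theorem sheet_package [FiniteDimensional ℝ F] (h4 : Module.finrank ℝ F = 4)
    {J : F → F →L[ℝ] F} (hJ : ContDiff ℝ ∞ J)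
    {b v : ℂ → F} {R₁ R₂ : ℝ} (hR₁ : 0 < R₁) (hR₂ : 0 < R₂)
    (hb : ContDiff ℝ ∞ b)
    (hbJ : ∀ z ∈ ball (0 : ℂ) R₁, ∀ α : ℂ,
      fderiv ℝ b z (Complex.I * α) = J (b z) (fderiv ℝ b z α))
    (hJ2 : ∀ z ∈ ball (0 : ℂ) R₁, ∀ w : F, J (b z) (J (b z) w) = -w)
    (hinj : Injective (fderiv ℝ b 0))
    (hv : ContDiff ℝ ∞ v)
    (hvJ : ∀ z ∈ ball (0 : ℂ) R₂, ∀ α : ℂ,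
      fderiv ℝ v z (Complex.I * α) = J (v z) (fderiv ℝ v z α))
    (hx : v 0 = b 0) :
    ∃ (ν₀ : F) (e : OpenPartialHomeomorph (ℂ × ℂ) F) (ρ₁ ρ M : ℝ),
      ⇑e = sheetChart J b ν₀ ∧ ((0, 0) : ℂ × ℂ) ∈ e.source ∧ ContDiffOn ℝ ∞ e.symm e.target ∧
      Injective (sheetChartDeriv J b ν₀ 0) ∧
      0 < ρ₁ ∧ (∀ ζ ∈ ball (0 : ℂ) ρ₁, v ζ ∈ e.target) ∧
      e.symm (v 0) = (0, 0) ∧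
      ContDiffOn ℝ ∞ (fun ζ => (e.symm (v ζ)).1) (ball 0 ρ₁) ∧
      ContDiffOn ℝ ∞ (fun ζ => (e.symm (v ζ)).2) (ball 0 ρ₁) ∧
      0 < ρ ∧ ρ < ρ₁ ∧
      ∀ ζ ∈ closedBall (0 : ℂ) ρ, ‖dbarAlong 1 (fun ζ => (e.symm (v ζ)).2) ζ‖ ≤
        M * ‖(e.symm (v ζ)).2‖ := by
  obtain ⟨ν₀, e, hcoe, hsrc, hsymm, r, B, hr, hball, hB⟩ :=
    exists_sheetChart_localInverse h4 hJ hb hinj (hbJ 0 (mem_ball_self hR₁))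
      (hJ2 0 (mem_ball_self hR₁))
  have hE : ContDiff ℝ ∞ (sheetChart J b ν₀) := contDiff_sheetChart hJ hb ν₀
  -- the differential at `(0,0)` is injective (lower bound on the ball)
  have hd0 : fderiv ℝ (sheetChart J b ν₀) (0, 0) = sheetChartDeriv J b ν₀ 0 :=
    (hasFDerivAt_sheetChart ((hb.differentiable (by simp)) 0)
      (((hJ.clm_apply contDiff_const).differentiable (by simp)) _)).fderiv
  have hinjE : Injective (sheetChartDeriv J b ν₀ 0) := by
    refine (injective_iff_map_eq_zero _).2 fun q hq => ?_
    have h := hB (0, 0) (mem_ball_self hr) q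
    rw [hd0, hq, norm_zero, mul_zero] at h
    exact norm_le_zero_iff.1 h
  -- a radius `r'` on which the axis is `J`-holomorphic
  set r' : ℝ := min r R₁ with hr'_def
  have hr' : 0 < r' := lt_min hr hR₁
  have hr'r : r' ≤ r := min_le_left _ _
  have hhol : ∀ ζ : ℂ, ‖ζ - 0‖ < r' → ∀ α β : ℂ,
      J ((sheetChart J b ν₀) (ζ, 0)) (fderiv ℝ (sheetChart J b ν₀) (ζ, 0) (α, β)) =
        fderiv ℝ (sheetChart J b ν₀) (ζ, 0) (Complex.I * α, Complex.I * β) := by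
    intro ζ hζ α β
    have hζ₁ : ζ ∈ ball (0 : ℂ) R₁ := by
      rw [mem_ball, dist_eq_norm]
      exact hζ.trans_le (min_le_right _ _)
    have hd : fderiv ℝ (sheetChart J b ν₀) (ζ, 0) = sheetChartDeriv J b ν₀ ζ :=
      (hasFDerivAt_sheetChart ((hb.differentiable (by simp)) ζ)
        (((hJ.clm_apply contDiff_const).differentiable (by simp)) _)).fderiv
    rw [hd, sheetChart_mk_zero]
    exact sheetChartDeriv_hol (hbJ ζ hζ₁) (hJ2 ζ hζ₁) α β
  have hB' : ∀ p ∈ ball ((0, 0) : ℂ × ℂ) r', ∀ q : ℂ × ℂ,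
      ‖q‖ ≤ B * ‖fderiv ℝ (sheetChart J b ν₀) p q‖ :=
    fun p hp q => hB p (ball_subset_ball hr'r hp) q
  -- a radius `ρ₁` about `0` on which `v` stays in the target and `e.symm ∘ v` in the small ball
  have hxt : v 0 ∈ e.target := by
    rw [hx, ← sheetChart_mk_zero J b ν₀ 0, ← hcoe]
    exact e.map_source hsrc
  have hsx : e.symm (v 0) = (0, 0) := by
    rw [hx, ← sheetChart_mk_zero J b ν₀ 0, ← hcoe]
    exact e.left_inv hsrc
  have hcont : ContinuousAt (fun ζ => e.symm (v ζ)) 0 :=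
    (e.continuousAt_symm hxt).comp hv.continuous.continuousAt
  have hev : ∀ᶠ ζ in 𝓝 (0 : ℂ), v ζ ∈ e.target ∧ e.symm (v ζ) ∈ ball ((0, 0) : ℂ × ℂ) r' := by
    filter_upwards [hv.continuous.continuousAt.preimage_mem_nhds (e.open_target.mem_nhds hxt),
      hcont.preimage_mem_nhds (isOpen_ball.mem_nhds (by rw [hsx]; exact mem_ball_self hr'))]
      with ζ h1 h2
    exact ⟨h1, h2⟩
  obtain ⟨ρ₁', hρ₁', hρ₁'b⟩ := Metric.eventually_nhds_iff_ball.1 hev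
  set ρ₁ : ℝ := min ρ₁' R₂ with hρ₁_def
  have hρ₁ : 0 < ρ₁ := lt_min hρ₁' hR₂
  have hρ₁b : ∀ ζ ∈ ball (0 : ℂ) ρ₁, v ζ ∈ e.target ∧ e.symm (v ζ) ∈ ball ((0, 0) : ℂ × ℂ) r' :=
    fun ζ hζ => hρ₁'b ζ (ball_subset_ball (min_le_left _ _) hζ)
  -- the coordinates `(a, c) = e.symm ∘ v`
  set a : ℂ → ℂ := fun ζ => (e.symm (v ζ)).1 with ha_def
  set c : ℂ → ℂ := fun ζ => (e.symm (v ζ)).2 with hc_def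
  have hac : ∀ ζ, (a ζ, c ζ) = e.symm (v ζ) := fun ζ => rfl
  have hsv : ContDiffOn ℝ ∞ (fun ζ => e.symm (v ζ)) (ball 0 ρ₁) :=
    hsymm.comp hv.contDiffOn fun ζ hζ => (hρ₁b ζ hζ).1
  have ha : ContDiffOn ℝ ∞ a (ball 0 ρ₁) := contDiff_fst.comp_contDiffOn hsv
  have hc : ContDiffOn ℝ ∞ c (ball 0 ρ₁) := contDiff_snd.comp_contDiffOn hsv
  have hin : ∀ ζ ∈ ball (0 : ℂ) ρ₁, (a ζ, c ζ) ∈ ball ((0, 0) : ℂ × ℂ) r' :=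
    fun ζ hζ => (hρ₁b ζ hζ).2
  have hEv : ∀ ζ ∈ ball (0 : ℂ) ρ₁, (sheetChart J b ν₀) (a ζ, c ζ) = v ζ := fun ζ hζ => by
    rw [hac, ← hcoe]
    exact e.right_inv (hρ₁b ζ hζ).1
  have hJhol : ∀ ζ ∈ ball (0 : ℂ) ρ₁, ∀ θ : ℂ,
      fderiv ℝ (fun ζ => (sheetChart J b ν₀) (a ζ, c ζ)) ζ (Complex.I * θ) =
        J ((sheetChart J b ν₀) (a ζ, c ζ))
          (fderiv ℝ (fun ζ => (sheetChart J b ν₀) (a ζ, c ζ)) ζ θ) := by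
    intro ζ hζ θ
    have heq : (fun ζ => (sheetChart J b ν₀) (a ζ, c ζ)) =ᶠ[𝓝 ζ] v := by
      filter_upwards [isOpen_ball.mem_nhds hζ] with ζ' hζ'
      exact hEv ζ' hζ'
    rw [heq.fderiv_eq, hEv ζ hζ]
    exact hvJ ζ (ball_subset_ball (min_le_right _ _) hζ) θ
  obtain ⟨ρ, M, hρ, hρρ₁, -, hbound⟩ := sheetDbarInequality_local J hJ (sheetChart J b ν₀) hE 0 r'
    B hr' hhol hB' a c 0 ρ₁ hρ₁ ha hc hin hJhol
  exact ⟨ν₀, e, ρ₁, ρ, M, hcoe, hsrc, hsymm, hinjE, hρ₁, fun ζ hζ => (hρ₁b ζ hζ).1, hsx, ha, hc,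
    hρ, hρρ₁, hbound⟩

/-- `ker dA = im db` at the point: the kernel of the differential of a leaf function `A`
(surjective onto `ℂ`, vanishing along the immersed sheet `b`) is the tangent plane of the sheet.
[folklore] -/
theorem ker_eq_range [FiniteDimensional ℝ F] (h4 : Module.finrank ℝ F = 4)
    {Db : ℂ →L[ℝ] F} {DA : F →L[ℝ] ℂ} (hinj : Injective Db) (hsurj : Surjective DA)
    (hcomp : ∀ α : ℂ, DA (Db α) = 0) :
    ∀ w : F, DA w = 0 → ∃ α : ℂ, Db α = w := by
  have hle : LinearMap.range (Db : ℂ →ₗ[ℝ] F) ≤ LinearMap.ker (DA : F →ₗ[ℝ] ℂ) := by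
    rintro w ⟨α, rfl⟩
    exact hcomp α
  have h1 : Module.finrank ℝ (LinearMap.range (Db : ℂ →ₗ[ℝ] F)) = 2 := by
    rw [LinearMap.finrank_range_of_inj hinj, Complex.finrank_real_complex]
  have h2 : Module.finrank ℝ (LinearMap.ker (DA : F →ₗ[ℝ] ℂ)) = 2 := by
    have h := LinearMap.finrank_range_add_finrank_ker (DA : F →ₗ[ℝ] ℂ)
    rw [LinearMap.range_eq_top.2 hsurj, finrank_top, Complex.finrank_real_complex, h4] at h
    omega
  have heq := Submodule.eq_of_le_of_finrank_eq hle (by rw [h1, h2])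
  intro w hw
  have : w ∈ LinearMap.range (Db : ℂ →ₗ[ℝ] F) := by rw [heq]; exact hw
  obtain ⟨α, hα⟩ := this
  exact ⟨α, hα⟩

/-- **Flat core: a `J`-holomorphic curve against an immersed `J`-holomorphic sheet, read through a
leaf function.** `dim F = 4`, `J` smooth; `b` a smooth sheet, `J`-holomorphic on `B(0,R₁)` with
`J² = -1` along it, immersed at `0`; `v` smooth, `J`-holomorphic on `B(0,R₂)`, `v 0 = b 0`; `A` a
smooth `ℂ`-valued function near `b 0`, vanishing along the sheet near `0`, with `dA_{b 0}` surjective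
and `J`-complex-linear. Then either `A ∘ v` vanishes identically near `0`, or `0` is an isolated
zero of `A ∘ v`, the winding number of `A ∘ v` along every small circle is an integer `k ≥ 1`
independent of the radius, and `k = 1` iff `d(A ∘ v)_0` is surjective.
[cite: McDuff1991LocalBehaviour, Thm 1.1 and §5 (5.1) case (i)] -/
theorem flat_leaf_dichotomy [FiniteDimensional ℝ F] (h4 : Module.finrank ℝ F = 4)
    {J : F → F →L[ℝ] F} (hJ : ContDiff ℝ ∞ J)
    {b v : ℂ → F} {R₁ R₂ : ℝ} (hR₁ : 0 < R₁) (hR₂ : 0 < R₂)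
    (hb : ContDiff ℝ ∞ b)
    (hbJ : ∀ z ∈ ball (0 : ℂ) R₁, ∀ α : ℂ,
      fderiv ℝ b z (Complex.I * α) = J (b z) (fderiv ℝ b z α))
    (hJ2 : ∀ z ∈ ball (0 : ℂ) R₁, ∀ w : F, J (b z) (J (b z) w) = -w)
    (hinj : Injective (fderiv ℝ b 0))
    (hv : ContDiff ℝ ∞ v)
    (hvJ : ∀ z ∈ ball (0 : ℂ) R₂, ∀ α : ℂ,
      fderiv ℝ v z (Complex.I * α) = J (v z) (fderiv ℝ v z α))
    (hx : v 0 = b 0)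
    {A : F → ℂ} {O : Set F} (hO : IsOpen O) (hbO : b 0 ∈ O) (hA : ContDiffOn ℝ ∞ A O)
    (hAb : ∀ᶠ α in 𝓝 (0 : ℂ), A (b α) = 0)
    (hAJ : ∀ w : F, fderiv ℝ A (b 0) (J (b 0) w) = Complex.I * fderiv ℝ A (b 0) w)
    (hAsurj : Surjective (fderiv ℝ A (b 0))) :
    (∀ᶠ ζ in 𝓝 (0 : ℂ), A (v ζ) = 0) ∨
    ∃ r₀ : ℝ, 0 < r₀ ∧ (∀ ζ : ℂ, 0 < ‖ζ‖ → ‖ζ‖ ≤ r₀ → A (v ζ) ≠ 0) ∧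
      ∃ k : ℕ, 1 ≤ k ∧
        (∀ r : ℝ, 0 < r → r ≤ r₀ → wind (fun t => A (v (circleLoop 0 r t))) = k) ∧
        (k = 1 ↔ Surjective (fderiv ℝ (fun ζ => A (v ζ)) 0)) := by
  obtain ⟨ν₀, e, ρ₁, ρ, M, hcoe, hsrc, hsymm, hinjE, hρ₁, htgt, hsx, ha, hc, hρ, hρρ₁, hbound⟩ :=
    sheet_package h4 hJ hR₁ hR₂ hb hbJ hJ2 hinj hv hvJ hx
  set E := sheetChart J b ν₀ with hE_def
  have hE : ContDiff ℝ ∞ E := contDiff_sheetChart hJ hb ν₀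
  set a : ℂ → ℂ := fun ζ => (e.symm (v ζ)).1 with ha_def
  set c : ℂ → ℂ := fun ζ => (e.symm (v ζ)).2 with hc_def
  have ha0 : a 0 = 0 := by simp only [ha_def, hsx]
  have hc0 : c 0 = 0 := by simp only [hc_def, hsx]
  have hEv : ∀ ζ ∈ ball (0 : ℂ) ρ₁, E (a ζ, c ζ) = v ζ := fun ζ hζ => by
    have h1 : E (a ζ, c ζ) = e (e.symm (v ζ)) := by rw [hcoe]
    rw [h1]
    exact e.right_inv (htgt ζ hζ)
  have hE00 : E (0, 0) = b 0 := sheetChart_mk_zero J b ν₀ 0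
  -- derivative data at the point
  set DE : ℂ × ℂ →L[ℝ] F := sheetChartDeriv J b ν₀ 0 with hDE_def
  have hdE : HasFDerivAt E DE (0, 0) :=
    hasFDerivAt_sheetChart ((hb.differentiable (by simp)) 0)
      (((hJ.clm_apply contDiff_const).differentiable (by simp)) _)
  have hDEax : ∀ θ : ℂ, DE (θ, 0) = fderiv ℝ b 0 θ := fun θ => by
    simp [hDE_def, sheetChartDeriv_apply]
  have hAd : DifferentiableAt ℝ A (b 0) :=
    (hA.differentiableOn (by simp)).differentiableAt (hO.mem_nhds hbO)
  set DA : F →L[ℝ] ℂ := fderiv ℝ A (b 0) with hDA_def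
  -- the composite `g₂ = A ∘ E`
  set g₂ : ℂ × ℂ → ℂ := fun p => A (E p) with hg₂_def
  have hg₂d : HasFDerivAt g₂ (DA.comp DE) (0, 0) := by
    have h : HasFDerivAt A DA (E (0, 0)) := by rw [hE00]; exact hAd.hasFDerivAt
    exact h.comp (0, 0) hdE
  have hWo : IsOpen (E ⁻¹' O) := hO.preimage hE.continuous
  have hW0 : ((0, 0) : ℂ × ℂ) ∈ E ⁻¹' O := by
    show E (0, 0) ∈ O
    rw [hE00]; exact hbO
  have hg₂s : ContDiffOn ℝ ∞ g₂ (E ⁻¹' O) := hA.comp hE.contDiffOn fun p hp => hp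
  have hg₂cont : ContinuousAt (fderiv ℝ g₂) (0, 0) :=
    (hg₂s.continuousOn_fderiv_of_isOpen hWo (by simp)).continuousAt (hWo.mem_nhds hW0)
  have hfd0 : fderiv ℝ g₂ (0, 0) = DA.comp DE := hg₂d.fderiv
  -- `g₂` vanishes on the axis near `0`
  have hg₂axis : ∀ᶠ α in 𝓝 (0 : ℂ), g₂ (α, 0) = 0 := by
    filter_upwards [hAb] with α hα
    show A (sheetChart J b ν₀ (α, 0)) = 0
    rw [sheetChart_mk_zero]; exact hα
  have hinl : ∀ θ : ℂ, DA (DE (θ, 0)) = 0 := by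
    intro θ
    have h1 : HasFDerivAt (fun α : ℂ => g₂ (α, 0))
        ((DA.comp DE).comp (ContinuousLinearMap.inl ℝ ℂ ℂ)) 0 := by
      have hf : HasFDerivAt (fun α : ℂ => ((α, 0) : ℂ × ℂ)) (ContinuousLinearMap.inl ℝ ℂ ℂ) 0 :=
        hasFDerivAt_prodMk_left (𝕜 := ℝ) (0 : ℂ) (0 : ℂ)
      exact HasFDerivAt.comp (0 : ℂ) (f := fun α : ℂ => ((α, 0) : ℂ × ℂ)) hg₂d hf
    have h2 : HasFDerivAt (fun α : ℂ => g₂ (α, 0)) (0 : ℂ →L[ℝ] ℂ) 0 := by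
      have heq : (fun α : ℂ => g₂ (α, 0)) =ᶠ[𝓝 0] fun _ => 0 := by
        filter_upwards [hg₂axis] with α hα
        exact hα
      exact (hasFDerivAt_const (0 : ℂ) (0 : ℂ)).congr_of_eventuallyEq heq
    have h3 := h1.unique h2
    have h4' := congrArg (fun T : ℂ →L[ℝ] ℂ => T θ) h3
    simpa using h4'
  have hDAb : ∀ θ : ℂ, DA (fderiv ℝ b 0 θ) = 0 := fun θ => by rw [← hDEax]; exact hinl θ
  -- the normal derivative `L γ = dA (dE (0, γ))` is multiplication by `lam ≠ 0`
  set L : ℂ →L[ℝ] ℂ := (DA.comp DE).comp (ContinuousLinearMap.inr ℝ ℂ ℂ) with hL_def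
  have hLapp : ∀ γ : ℂ, L γ = DA (DE (0, γ)) := fun γ => rfl
  have hLI : ∀ γ : ℂ, L (Complex.I * γ) = Complex.I * L γ := by
    intro γ
    rw [hLapp, hLapp]
    have h := sheetChartDeriv_hol (ν₀ := ν₀) (hbJ 0 (mem_ball_self hR₁))
      (hJ2 0 (mem_ball_self hR₁)) 0 γ
    rw [mul_zero] at h
    rw [← hDE_def] at h
    rw [← h, hDA_def, hAJ]
  set lam : ℂ := L 1 with hlam_def
  have hLmul : ∀ γ : ℂ, L γ = γ * lam := apply_eq_mul_of_map_I_mul L hLI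
  have hlam : lam ≠ 0 := by
    intro hlam0
    have h1 : DA (DE (0, 1)) = 0 := by rw [← hLapp, hLmul, hlam0, mul_zero]
    obtain ⟨α, hα⟩ := ker_eq_range h4 hinj hAsurj hDAb _ h1
    have h2 : DE (α, 0) = DE (0, 1) := by rw [hDEax, hα]
    have h3 := congrArg Prod.snd (hinjE h2)
    simp at h3
  -- mean value: `‖g₂ (α, γ) - γ lam‖ ≤ ε ‖γ‖` for `(α, γ)` small
  have hmv : ∀ ε : ℝ, 0 < ε → ∃ δ : ℝ, 0 < δ ∧ ∀ α γ : ℂ, ‖α‖ < δ → ‖γ‖ < δ →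
      ‖g₂ (α, γ) - γ * lam‖ ≤ ε * ‖γ‖ := by
    intro ε hε
    have h1 : ∀ᶠ p in 𝓝 ((0, 0) : ℂ × ℂ),
        ‖fderiv ℝ g₂ p - fderiv ℝ g₂ (0, 0)‖ < ε ∧ p ∈ E ⁻¹' O := by
      refine Filter.Eventually.and ?_ (hWo.mem_nhds hW0)
      have h := Metric.tendsto_nhds.1 hg₂cont ε hε
      exact h.mono fun p hp => by rwa [dist_eq_norm] at hp
    obtain ⟨δ₁, hδ₁, hb₁⟩ := Metric.eventually_nhds_iff_ball.1 h1
    obtain ⟨δ₂, hδ₂, hb₂⟩ := Metric.eventually_nhds_iff_ball.1 hg₂axis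
    refine ⟨min δ₁ δ₂, lt_min hδ₁ hδ₂, fun α γ hα hγ => ?_⟩
    have hα₁ : ‖α‖ < δ₁ := hα.trans_le (min_le_left _ _)
    have hγ₁ : ‖γ‖ < δ₁ := hγ.trans_le (min_le_left _ _)
    have hmem : ∀ γ' ∈ ball (0 : ℂ) δ₁, ((α, γ') : ℂ × ℂ) ∈ ball ((0, 0) : ℂ × ℂ) δ₁ := by
      intro γ' hγ'
      rw [mem_ball, Prod.dist_eq, max_lt_iff]
      exact ⟨by simpa using hα₁, by simpa using hγ'⟩
    have hdiffp : ∀ γ' ∈ ball (0 : ℂ) δ₁, DifferentiableAt ℝ g₂ (α, γ') := fun γ' hγ' =>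
      (hg₂s.differentiableOn (by simp)).differentiableAt
        (hWo.mem_nhds (hb₁ _ (hmem γ' hγ')).2)
    have key := Convex.norm_image_sub_le_of_norm_fderiv_le' (𝕜 := ℝ)
      (f := fun γ' : ℂ => g₂ (α, γ')) (s := ball (0 : ℂ) δ₁) (φ := L) (C := ε) (x := 0) (y := γ)
      (fun γ' hγ' => (hdiffp γ' hγ').comp γ' (differentiableAt_const _ |>.prodMk differentiableAt_id))
      (fun γ' hγ' => by
        have hd : fderiv ℝ (fun γ' : ℂ => g₂ (α, γ')) γ' =
            (fderiv ℝ g₂ (α, γ')).comp (ContinuousLinearMap.inr ℝ ℂ ℂ) := by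
          have hf : HasFDerivAt (fun γ' : ℂ => ((α, γ') : ℂ × ℂ)) (ContinuousLinearMap.inr ℝ ℂ ℂ)
              γ' := hasFDerivAt_prodMk_right (𝕜 := ℝ) α γ'
          exact ((hdiffp γ' hγ').hasFDerivAt.comp γ' hf).fderiv
        rw [hd, hL_def, ← hfd0, ← ContinuousLinearMap.sub_comp]
        refine ContinuousLinearMap.opNorm_le_bound _ hε.le fun θ => ?_
        rw [ContinuousLinearMap.comp_apply, ContinuousLinearMap.inr_apply]
        calc ‖(fderiv ℝ g₂ (α, γ') - fderiv ℝ g₂ (0, 0)) (0, θ)‖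
            ≤ ‖fderiv ℝ g₂ (α, γ') - fderiv ℝ g₂ (0, 0)‖ * ‖((0 : ℂ), θ)‖ :=
              ContinuousLinearMap.le_opNorm _ _
          _ ≤ ε * ‖θ‖ := by
              gcongr
              · exact (hb₁ _ (hmem γ' hγ')).1.le
              · simp [Prod.norm_def])
      (convex_ball 0 δ₁) (mem_ball_self hδ₁) (mem_ball_zero_iff.2 hγ₁)
    have hax : g₂ (α, 0) = 0 := hb₂ α (mem_ball_zero_iff.2 (hα.trans_le (min_le_right _ _)))
    simpa only [hax, sub_zero, hLmul] using key
  -- along the curve: `‖A (v ζ) - c ζ lam‖ ≤ ‖lam‖/2 ‖c ζ‖` for `ζ` small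
  have hcurve : ∃ r₃ : ℝ, 0 < r₃ ∧ r₃ ≤ ρ₁ ∧ (∀ ζ : ℂ, ‖ζ‖ < r₃ → v ζ ∈ O) ∧
      ∀ ζ : ℂ, ‖ζ‖ < r₃ → ‖A (v ζ) - c ζ * lam‖ ≤ ‖lam‖ / 2 * ‖c ζ‖ := by
    obtain ⟨δ, hδ, hmvδ⟩ := hmv (‖lam‖ / 2) (by positivity)
    have hpc : ContinuousAt (fun ζ => e.symm (v ζ)) 0 :=
      (e.continuousAt_symm (htgt 0 (mem_ball_self hρ₁))).comp hv.continuous.continuousAt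
    have hev : ∀ᶠ ζ in 𝓝 (0 : ℂ), e.symm (v ζ) ∈ ball ((0, 0) : ℂ × ℂ) δ ∧ v ζ ∈ O ∧
        ζ ∈ ball (0 : ℂ) ρ₁ := by
      have h1 : (fun ζ => e.symm (v ζ)) ⁻¹' ball ((0, 0) : ℂ × ℂ) δ ∈ 𝓝 (0 : ℂ) :=
        hpc.preimage_mem_nhds (by rw [hsx]; exact ball_mem_nhds _ hδ)
      have h2 : v ⁻¹' O ∈ 𝓝 (0 : ℂ) :=
        hv.continuous.continuousAt.preimage_mem_nhds (hO.mem_nhds (by rw [hx]; exact hbO))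
      filter_upwards [h1, h2, ball_mem_nhds (0 : ℂ) hρ₁] with ζ h1 h2 h3
      exact ⟨h1, h2, h3⟩
    obtain ⟨r₃, hr₃, hb₃⟩ := Metric.eventually_nhds_iff_ball.1 hev
    refine ⟨min r₃ ρ₁, lt_min hr₃ hρ₁, min_le_right _ _,
      fun ζ hζ => (hb₃ ζ (mem_ball_zero_iff.2 (hζ.trans_le (min_le_left _ _)))).2.1,
      fun ζ hζ => ?_⟩
    obtain ⟨h1, -, h3⟩ := hb₃ ζ (mem_ball_zero_iff.2 (hζ.trans_le (min_le_left _ _)))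
    have h1' : ‖a ζ‖ < δ ∧ ‖c ζ‖ < δ := by
      rw [mem_ball, Prod.dist_eq, max_lt_iff] at h1
      simpa [ha_def, hc_def] using h1
    have h := hmvδ (a ζ) (c ζ) h1'.1 h1'.2
    have hg₂v : g₂ (a ζ, c ζ) = A (v ζ) := by
      show A (E (a ζ, c ζ)) = A (v ζ)
      rw [hEv ζ h3]
    rwa [hg₂v] at h
  -- `∂̄ c (0) = 0`
  have hdbar0 : dbarAlong 1 c 0 = 0 := by
    have h := hbound 0 (mem_closedBall_self hρ.le)
    change ‖dbarAlong 1 c 0‖ ≤ M * ‖c 0‖ at h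
    rw [hc0, norm_zero, mul_zero] at h
    exact norm_le_zero_iff.1 h
  by_cases hne : ∃ᶠ ζ in 𝓝 (0 : ℂ), c ζ ≠ 0
  · -- isolated intersection of positive index
    right
    obtain ⟨S, ρ', H, hρ', -, hH, hcomp, hwind⟩ := exists_local_comparison c (ρ / 2) M
      (half_pos hρ) (hc.mono (ball_subset_ball (by linarith)))
      (fun ζ hζ => hbound ζ (closedBall_subset_closedBall (by linarith) hζ))
    obtain ⟨r₁, hr₁, hcz, k, hk, hwk, hkiff⟩ :=
      index_of_comparison hρ₁ hρ' hc hc0 hdbar0 hH hcomp hwind hne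
    obtain ⟨r₃, hr₃, hr₃ρ₁, hvO, hcurve⟩ := hcurve
    set r₀ : ℝ := min r₁ (r₃ / 2) with hr₀_def
    have hr₀ : 0 < r₀ := lt_min hr₁ (by positivity)
    have hr₀r₁ : r₀ ≤ r₁ := min_le_left _ _
    have hr₀r₃ : r₀ < r₃ := lt_of_le_of_lt (min_le_right _ _) (by linarith)
    have hAc : Continuous fun p : {p : F // p ∈ O} => A p :=
      hA.continuousOn.comp_continuous continuous_subtype_val fun p => p.2
    refine ⟨r₀, hr₀, fun ζ hζ hζr hA0 => ?_, k, hk, fun r hr hrr => ?_, ?_⟩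
    · have hcz' := hcz ζ hζ (hζr.trans hr₀r₁)
      have h := hcurve ζ (lt_of_le_of_lt hζr hr₀r₃)
      rw [hA0, zero_sub, norm_neg, norm_mul] at h
      have hcpos : 0 < ‖c ζ‖ := norm_pos_iff.2 hcz'
      have hlpos : 0 < ‖lam‖ := norm_pos_iff.2 hlam
      nlinarith
    · have hrρ₁ : r < ρ₁ := by linarith [hrr.trans_lt hr₀r₃]
      have hnorm : ∀ t : ℝ, ‖circleLoop 0 r t‖ = r := fun t => by
        simpa [abs_of_pos hr] using norm_circleLoop_sub_center 0 r t
      have hloopc : IsNonvanishingLoop fun t => c (circleLoop 0 r t) :=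
        ⟨(hc.continuousOn.comp (continuous_circleLoop 0 r).continuousOn fun t _ =>
            mem_ball_zero_iff.2 (by rw [hnorm]; exact hrρ₁)),
          fun t _ => hcz _ (by rw [hnorm]; exact hr) (by rw [hnorm]; exact hrr.trans hr₀r₁),
          by rw [circleLoop_zero_eq]⟩
      have hloopg : IsNonvanishingLoop fun t => c (circleLoop 0 r t) * lam :=
        hloopc.mul (IsNonvanishingLoop.const hlam)
      have hcontAv : Continuous fun t : ℝ => A (v (circleLoop 0 r t)) := by
        have hmem : ∀ t : ℝ, v (circleLoop 0 r t) ∈ O := fun t =>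
          hvO _ (by rw [hnorm]; exact hrr.trans_lt hr₀r₃)
        exact hA.continuousOn.comp_continuous (hv.continuous.comp (continuous_circleLoop 0 r)) hmem
      calc wind (fun t => A (v (circleLoop 0 r t)))
          = wind (fun t => c (circleLoop 0 r t) * lam) := by
            refine wind_eq_of_norm_sub_lt hcontAv.continuousOn (by rw [circleLoop_zero_eq]) hloopg
              fun t ht => ?_
            have h := hcurve (circleLoop 0 r t) (by rw [hnorm]; exact hrr.trans_lt hr₀r₃)
            have hcpos : 0 < ‖c (circleLoop 0 r t)‖ := norm_pos_iff.2 (hloopc.ne_zero t ht)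
            have hlpos : 0 < ‖lam‖ := norm_pos_iff.2 hlam
            calc ‖A (v (circleLoop 0 r t)) - c (circleLoop 0 r t) * lam‖
                ≤ ‖lam‖ / 2 * ‖c (circleLoop 0 r t)‖ := h
              _ < ‖lam‖ * ‖c (circleLoop 0 r t)‖ := by nlinarith
              _ = ‖c (circleLoop 0 r t) * lam‖ := by rw [norm_mul, mul_comm]
        _ = wind (fun t => lam * c (circleLoop 0 r t)) := by
            exact wind_congr fun t _ => mul_comm _ _
        _ = wind (fun t => c (circleLoop 0 r t)) := wind_const_mul hloopc hlam
        _ = k := hwk r hr (hrr.trans hr₀r₁)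
    · -- `k = 1 ↔ d(A ∘ v)_0` surjective, via `d(A ∘ v)_0 = L ∘ dc_0`
      rw [hkiff]
      have had : HasFDerivAt a (fderiv ℝ a 0) 0 :=
        ((ha.differentiableOn (by simp)).differentiableAt (ball_mem_nhds 0 hρ₁)).hasFDerivAt
      have hcd : HasFDerivAt c (fderiv ℝ c 0) 0 :=
        ((hc.differentiableOn (by simp)).differentiableAt (ball_mem_nhds 0 hρ₁)).hasFDerivAt
      have hcomp_deriv : fderiv ℝ (fun ζ => A (v ζ)) 0 = L.comp (fderiv ℝ c 0) := by
        have heq : (fun ζ => A (v ζ)) =ᶠ[𝓝 0] fun ζ => g₂ (a ζ, c ζ) := by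
          filter_upwards [ball_mem_nhds (0 : ℂ) hρ₁] with ζ hζ
          show A (v ζ) = A (E (a ζ, c ζ))
          rw [hEv ζ hζ]
        rw [heq.fderiv_eq]
        have hpair : HasFDerivAt (fun ζ => (a ζ, c ζ)) ((fderiv ℝ a 0).prod (fderiv ℝ c 0)) 0 :=
          had.prodMk hcd
        have hg₂d' : HasFDerivAt g₂ (DA.comp DE) ((fun ζ => (a ζ, c ζ)) 0) := by
          show HasFDerivAt g₂ (DA.comp DE) (a 0, c 0)
          rw [ha0, hc0]; exact hg₂d
        have hcomp' : HasFDerivAt (fun ζ => g₂ (a ζ, c ζ))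
            ((DA.comp DE).comp ((fderiv ℝ a 0).prod (fderiv ℝ c 0))) 0 :=
          HasFDerivAt.comp (0 : ℂ) (f := fun ζ => (a ζ, c ζ)) hg₂d' hpair
        rw [hcomp'.fderiv]
        refine ContinuousLinearMap.ext fun θ => ?_
        show DA (DE (fderiv ℝ a 0 θ, fderiv ℝ c 0 θ)) = L (fderiv ℝ c 0 θ)
        have hsplit : ((fderiv ℝ a 0 θ, fderiv ℝ c 0 θ) : ℂ × ℂ) =
            ((fderiv ℝ a 0 θ, (0 : ℂ)) : ℂ × ℂ) + (((0 : ℂ), fderiv ℝ c 0 θ) : ℂ × ℂ) := by simp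
        rw [hsplit, map_add, map_add, hinl, zero_add, hLapp]
      rw [hcomp_deriv]
      constructor
      · intro hD
        set μ : ℂ := fderiv ℝ c 0 1 with hμ_def
        have hμ : ∀ ζ : ℂ, fderiv ℝ c 0 ζ = ζ * μ := fderiv_apply_eq_mul_of_dbar_zero hdbar0
        have hμ0 : μ ≠ 0 := fun hμ0 => hD (ContinuousLinearMap.ext fun ζ => by
          rw [hμ ζ, hμ0, mul_zero]; rfl)
        intro w
        refine ⟨w / (μ * lam), ?_⟩
        rw [ContinuousLinearMap.comp_apply, hμ, hLmul]
        field_simp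
      · intro hsurj hD0
        obtain ⟨ζ, hζ⟩ := hsurj 1
        rw [ContinuousLinearMap.comp_apply, hD0] at hζ
        simp at hζ
  · -- nested: the curve lies in the sheet near `0`
    left
    have hev0 : ∀ᶠ ζ in 𝓝 (0 : ℂ), c ζ = 0 := by
      simpa [Filter.not_frequently] using hne
    have hac : ContinuousAt a 0 := ha.continuousOn.continuousAt (ball_mem_nhds 0 hρ₁)
    have ha_small : ∀ᶠ ζ in 𝓝 (0 : ℂ), A (b (a ζ)) = 0 := by
      have h : Tendsto a (𝓝 0) (𝓝 0) := by simpa [ContinuousAt, ha0] using hac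
      exact h.eventually hAb
    filter_upwards [hev0, ha_small, ball_mem_nhds (0 : ℂ) hρ₁] with ζ hζ hAζ hζρ
    rw [← hEv ζ hζρ]
    show A (sheetChart J b ν₀ (a ζ, c ζ)) = 0
    rw [hζ, sheetChart_mk_zero]
    exact hAζ

/-! ### Transport from the manifold to the chart -/

/-- Gluing: `χ • f` is globally `C^n` when `χ ∈ C^n` has `tsupport χ ⊆ D`, `D` open, and `f` is
`C^n` on `D` only (real scalars, any real normed target).
[folklore] -/
theorem contDiff_smul_of_tsupport_subset_real {E' G : Type*} [NormedAddCommGroup E']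
    [NormedSpace ℝ E'] [NormedAddCommGroup G] [NormedSpace ℝ G]
    {χ : E' → ℝ} {f : E' → G} {D : Set E'} {n : WithTop ℕ∞}
    (hD : IsOpen D) (hχ : ContDiff ℝ n χ) (hsub : tsupport χ ⊆ D) (hf : ContDiffOn ℝ n f D) :
    ContDiff ℝ n fun x => χ x • f x := by
  refine contDiff_iff_contDiffAt.2 fun x => ?_
  by_cases hx : x ∈ D
  · exact hχ.contDiffAt.smul (hf.contDiffAt (hD.mem_nhds hx))
  · have h0 : (fun y => χ y • f y) =ᶠ[𝓝 x] fun _ => 0 := by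
      filter_upwards [(notMem_tsupport_iff_eventuallyEq.1 fun h => hx (hsub h))] with y hy
      simp [hy]
    exact contDiffAt_const.congr_of_eventuallyEq h0

variable {X : Type*} [TopologicalSpace X] [ChartedSpace (EuclideanSpace ℝ (Fin 4)) X]
  [IsManifold (𝓡 4) ∞ X]

/-- **The almost complex structure read in a chart, globalised by a cut-off.** For `y : X` there
is a smooth operator field `Jf` on `ℝ⁴` which, on a ball about the chart image of `y`, is `JX`
conjugated by the differential of the extended chart at `y`.
[folklore] -/
theorem exists_flatJ (JX : AlmostComplexStructure (𝓡 4) ∞ X) (y : X) :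
    ∃ (Jf : (EuclideanSpace ℝ (Fin 4)) → (EuclideanSpace ℝ (Fin 4)) →L[ℝ] (EuclideanSpace ℝ (Fin 4))) (rJ : ℝ), ContDiff ℝ ∞ Jf ∧ 0 < rJ ∧
      ball (extChartAt (𝓡 4) y y) rJ ⊆ (extChartAt (𝓡 4) y).target ∧
      ∀ x ∈ (extChartAt (𝓡 4) y).source,
        extChartAt (𝓡 4) y x ∈ ball (extChartAt (𝓡 4) y y) rJ →
        ∀ V : (EuclideanSpace ℝ (Fin 4)), Jf (extChartAt (𝓡 4) y x) V =
          mfderiv (𝓡 4) 𝓘(ℝ, (EuclideanSpace ℝ (Fin 4))) (extChartAt (𝓡 4) y) x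
            (JX x (mfderivWithin 𝓘(ℝ, (EuclideanSpace ℝ (Fin 4))) (𝓡 4) (extChartAt (𝓡 4) y).symm (range (𝓡 4))
              (extChartAt (𝓡 4) y x) V)) := by
  set φ := extChartAt (𝓡 4) y with hφ
  set eJ := trivializationAt ((EuclideanSpace ℝ (Fin 4)) →L[ℝ] (EuclideanSpace ℝ (Fin 4)))
    (fun x : X => TangentSpace (𝓡 4) x →L[ℝ] TangentSpace (𝓡 4) x) y with heJ
  set JXc : X → ((EuclideanSpace ℝ (Fin 4)) →L[ℝ] (EuclideanSpace ℝ (Fin 4))) := fun x => (eJ ⟨x, JX x⟩).2 with hJXc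
  have hbase : eJ.baseSet = (chartAt (EuclideanSpace ℝ (Fin 4)) y).source := by
    rw [heJ, hom_trivializationAt_baseSet, TangentBundle.trivializationAt_baseSet, inter_self]
  have hsmooth : ContMDiffOn (𝓡 4) 𝓘(ℝ, (EuclideanSpace ℝ (Fin 4)) →L[ℝ] (EuclideanSpace ℝ (Fin 4))) ∞ JXc eJ.baseSet :=
    (eJ.contMDiffOn_section_baseSet_iff (IB := 𝓡 4) (n := ∞)
      (s := fun x : X => (JX x : TangentSpace (𝓡 4) x →L[ℝ] TangentSpace (𝓡 4) x))).1
      JX.contMDiff.contMDiffOn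
  have h1 : ContMDiffOn 𝓘(ℝ, (EuclideanSpace ℝ (Fin 4))) 𝓘(ℝ, (EuclideanSpace ℝ (Fin 4)) →L[ℝ] (EuclideanSpace ℝ (Fin 4))) ∞ (JXc ∘ φ.symm) φ.target :=
    hsmooth.comp (contMDiffOn_extChartAt_symm y) fun p hp => by
      rw [hbase, ← extChartAt_source (𝓡 4)]
      exact φ.map_target hp
  have h2 : ContDiffOn ℝ ∞ (JXc ∘ φ.symm) φ.target := contMDiffOn_iff_contDiffOn.1 h1
  obtain ⟨ε, hε, hεt⟩ := Metric.isOpen_iff.1 (isOpen_extChartAt_target y) (φ y)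
    (mem_extChartAt_target y)
  let χ : ContDiffBump (φ y) := ⟨ε / 4, ε / 2, by positivity, by linarith⟩
  refine ⟨fun p => (χ p) • JXc (φ.symm p), ε / 4, ?_, by positivity,
    (ball_subset_ball (by linarith)).trans hεt, fun x hx hxb V => ?_⟩
  · refine contDiff_smul_of_tsupport_subset_real (isOpen_extChartAt_target y) χ.contDiff ?_ h2
    rw [χ.tsupport_eq]
    show closedBall (φ y) (ε / 2) ⊆ _
    exact (closedBall_subset_ball (by linarith)).trans hεt
  · have hχ1 : χ (φ x) = 1 := χ.one_of_mem_closedBall (ball_subset_closedBall hxb)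
    have hxc : x ∈ (chartAt (EuclideanSpace ℝ (Fin 4)) y).source := by rwa [← extChartAt_source (𝓡 4)]
    simp only [hχ1, one_smul]
    rw [φ.left_inv hx]
    change (ContinuousLinearMap.inCoordinates (EuclideanSpace ℝ (Fin 4)) (TangentSpace (𝓡 4)) (EuclideanSpace ℝ (Fin 4)) (TangentSpace (𝓡 4))
      y x y x (JX x)) V = _
    rw [ContinuousLinearMap.inCoordinates, TangentBundle.continuousLinearMapAt_trivializationAt hxc,
      TangentBundle.symmL_trivializationAt hxc]
    rfl
end LeafPositivity

open LeafPositivity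

/-- **Positivity of intersections, local index form with a leaf coordinate** — discharge of the
named fact `positivityOfIntersections_leafCoordinate`.
[cite: Wendl2018, §2.2.2 (p. 72) and Thm. 2.49] -/
theorem positivityOfIntersections_leafCoordinate_holds :
    positivityOfIntersections_leafCoordinate := by
  intro X _ _ _ _ _ JX u w N a hu huJ hw hwJ huw hwinj hN hwN ha hasurj hzero hcl
  set φ := extChartAt (𝓡 4) (w 0) with hφ
  obtain ⟨Jf, rJ, hJf, hrJ, hballt, hJfeq⟩ := exists_flatJ JX (w 0)
  have hrange : range (𝓡 4) = (univ : Set (EuclideanSpace ℝ (Fin 4))) := by simp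
  -- the chart identities
  have hK1 : ∀ x ∈ φ.source, ∀ Z : TangentSpace (𝓡 4) x,
      mfderivWithin 𝓘(ℝ, (EuclideanSpace ℝ (Fin 4))) (𝓡 4) φ.symm (range (𝓡 4)) (φ x)
        (mfderiv (𝓡 4) 𝓘(ℝ, (EuclideanSpace ℝ (Fin 4))) φ x Z) = Z := fun x hx Z => by
    have h := mfderivWithin_extChartAt_symm_comp_mfderiv_extChartAt' (I := 𝓡 4) hx
    exact congrArg (fun T : TangentSpace (𝓡 4) x →L[ℝ] TangentSpace (𝓡 4) x => T Z) h
  have hK2 : ∀ x ∈ φ.source, ∀ V : (EuclideanSpace ℝ (Fin 4)),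
      mfderiv (𝓡 4) 𝓘(ℝ, (EuclideanSpace ℝ (Fin 4))) φ x
        (mfderivWithin 𝓘(ℝ, (EuclideanSpace ℝ (Fin 4))) (𝓡 4) φ.symm (range (𝓡 4)) (φ x) V) = V := fun x hx V => by
    have h := mfderiv_extChartAt_comp_mfderivWithin_extChartAt_symm' (I := 𝓡 4) hx
    exact congrArg (fun T : (EuclideanSpace ℝ (Fin 4)) →L[ℝ] (EuclideanSpace ℝ (Fin 4)) => T V) h
  -- a radius `δ` of good behaviour for `u` and `w`
  have hy0 : w 0 ∈ φ.source := mem_extChartAt_source (w 0)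
  have hu0 : u 0 ∈ φ.source := by rw [huw]; exact hy0
  have hcw : ContinuousAt (fun z => φ (w z)) 0 :=
    (continuousAt_extChartAt' hy0).comp hw.continuous.continuousAt
  have hcu : ContinuousAt (fun z => φ (u z)) 0 :=
    (continuousAt_extChartAt' hu0).comp hu.continuous.continuousAt
  have hev : ∀ᶠ z in 𝓝 (0 : ℂ), w z ∈ φ.source ∧ φ (w z) ∈ ball (φ (w 0)) rJ ∧
      u z ∈ φ.source ∧ φ (u z) ∈ ball (φ (w 0)) rJ ∧ u z ∈ N := by
    have h1 : w ⁻¹' φ.source ∈ 𝓝 (0 : ℂ) :=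
      hw.continuous.continuousAt.preimage_mem_nhds ((isOpen_extChartAt_source (w 0)).mem_nhds hy0)
    have h2 : (fun z => φ (w z)) ⁻¹' ball (φ (w 0)) rJ ∈ 𝓝 (0 : ℂ) :=
      hcw.preimage_mem_nhds (ball_mem_nhds _ hrJ)
    have h3 : u ⁻¹' φ.source ∈ 𝓝 (0 : ℂ) :=
      hu.continuous.continuousAt.preimage_mem_nhds ((isOpen_extChartAt_source (w 0)).mem_nhds hu0)
    have h4 : (fun z => φ (u z)) ⁻¹' ball (φ (w 0)) rJ ∈ 𝓝 (0 : ℂ) :=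
      hcu.preimage_mem_nhds (by rw [huw]; exact ball_mem_nhds _ hrJ)
    have h5 : u ⁻¹' N ∈ 𝓝 (0 : ℂ) :=
      hu.continuous.continuousAt.preimage_mem_nhds (hN.mem_nhds (by rw [huw]; exact hwN))
    filter_upwards [h1, h2, h3, h4, h5] with z h1 h2 h3 h4 h5
    exact ⟨h1, h2, h3, h4, h5⟩
  obtain ⟨δ, hδ, hballδ⟩ := Metric.eventually_nhds_iff_ball.1 hev
  -- the reparametrisation `σ` (identity near `0`, values in `B(0, δ)`)
  let ψ : ContDiffBump (0 : ℂ) := ⟨δ / 4, δ / 2, by positivity, by linarith⟩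
  set σ : ℂ → ℂ := fun z => (ψ z) • z with hσ_def
  have hσs : ContDiff ℝ ∞ σ := ψ.contDiff.smul contDiff_id
  have hσball : ∀ z : ℂ, σ z ∈ ball (0 : ℂ) δ := by
    intro z
    rw [mem_ball_zero_iff, hσ_def]
    by_cases hz : z ∈ ball (0 : ℂ) (δ / 2)
    · simp only [norm_smul, Real.norm_eq_abs, abs_of_nonneg (ψ.nonneg)]
      have h1 : ψ z * ‖z‖ ≤ 1 * ‖z‖ := by gcongr; exact ψ.le_one
      have h2 := mem_ball_zero_iff.1 hz
      linarith
    · have h0 : ψ z = 0 := by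
        have : z ∉ Function.support ψ := by rw [ψ.support_eq]; exact hz
        simpa [Function.mem_support] using this
      simp [h0, hδ]
  have hσid : ∀ z ∈ ball (0 : ℂ) (δ / 4), σ z = z := fun z hz => by
    rw [hσ_def]
    simp only [ψ.one_of_mem_closedBall (ball_subset_closedBall hz), one_smul]
  have hσ0 : σ 0 = 0 := by simp [hσ_def]
  have hδ4 : 0 < δ / 4 := by positivity
  have hb4δ : ball (0 : ℂ) (δ / 4) ⊆ ball 0 δ := ball_subset_ball (by linarith)
  -- the flat curves
  set b : ℂ → (EuclideanSpace ℝ (Fin 4)) := fun z => φ (w (σ z)) with hb_def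
  set vf : ℂ → (EuclideanSpace ℝ (Fin 4)) := fun z => φ (u (σ z)) with hvf_def
  have hsmooth : ∀ {f : ℂ → X}, ContMDiff 𝓘(ℝ, ℂ) (𝓡 4) ∞ f →
      (∀ z ∈ ball (0 : ℂ) δ, f z ∈ φ.source) → ContDiff ℝ ∞ fun z => φ (f (σ z)) := by
    intro f hf hfs
    rw [← contMDiff_iff_contDiff]
    have h1 : ContMDiff 𝓘(ℝ, ℂ) (𝓡 4) ∞ (fun z => f (σ z)) :=
      hf.comp (contMDiff_iff_contDiff.2 hσs)
    exact (contMDiffOn_extChartAt (I := 𝓡 4) (x := w 0) (n := ∞)).comp_contMDiff h1 fun z => by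
      rw [← extChartAt_source (𝓡 4)]
      exact hfs (σ z) (hσball z)
  have hb : ContDiff ℝ ∞ b := hsmooth hw fun z hz => (hballδ z hz).1
  have hvf : ContDiff ℝ ∞ vf := hsmooth hu fun z hz => (hballδ z hz).2.2.1
  -- derivatives on `B(0, δ/4)`
  have hder : ∀ {f : ℂ → X}, ContMDiff 𝓘(ℝ, ℂ) (𝓡 4) ∞ f →
      (∀ z ∈ ball (0 : ℂ) δ, f z ∈ φ.source) → ∀ z ∈ ball (0 : ℂ) (δ / 4), ∀ α : ℂ,
      fderiv ℝ (fun z => φ (f (σ z))) z α =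
        mfderiv (𝓡 4) 𝓘(ℝ, (EuclideanSpace ℝ (Fin 4))) φ (f z) (mfderiv 𝓘(ℝ, ℂ) (𝓡 4) f z α) := by
    intro f hf hfs z hz α
    have heq : (fun z => φ (f (σ z))) =ᶠ[𝓝 z] (φ ∘ f) := by
      filter_upwards [isOpen_ball.mem_nhds hz] with z' hz'
      show φ (f (σ z')) = φ (f z')
      rw [hσid z' hz']
    rw [heq.fderiv_eq, ← mfderiv_eq_fderiv]
    have hfz := hfs z (hb4δ hz)
    have hφd : MDifferentiableAt (𝓡 4) 𝓘(ℝ, (EuclideanSpace ℝ (Fin 4))) φ (f z) :=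
      mdifferentiableAt_extChartAt (by rwa [← extChartAt_source (𝓡 4)])
    have hfd : MDifferentiableAt 𝓘(ℝ, ℂ) (𝓡 4) f z := hf.mdifferentiableAt (by simp)
    rw [mfderiv_comp z hφd hfd]
    rfl
  have hbder := hder hw fun z hz => (hballδ z hz).1
  have hvder := hder hu fun z hz => (hballδ z hz).2.2.1
  have hbz : ∀ z ∈ ball (0 : ℂ) (δ / 4), b z = φ (w z) := fun z hz => by
    show φ (w (σ z)) = φ (w z); rw [hσid z hz]
  have hvz : ∀ z ∈ ball (0 : ℂ) (δ / 4), vf z = φ (u z) := fun z hz => by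
    show φ (u (σ z)) = φ (u z); rw [hσid z hz]
  -- Cauchy–Riemann equations in the chart
  have hCR : ∀ {f : ℂ → X} (hf : ContMDiff 𝓘(ℝ, ℂ) (𝓡 4) ∞ f)
      (hfs : ∀ z ∈ ball (0 : ℂ) δ, f z ∈ φ.source),
      (∀ z ∈ ball (0 : ℂ) δ, φ (f z) ∈ ball (φ (w 0)) rJ) →
      IsJHolomorphic (𝓡 4) (fun x => JX x) f →
      ∀ z ∈ ball (0 : ℂ) (δ / 4), ∀ α : ℂ,
        fderiv ℝ (fun z => φ (f (σ z))) z (Complex.I * α) =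
          Jf (φ (f (σ z))) (fderiv ℝ (fun z => φ (f (σ z))) z α) := by
    intro f hf hfs hfb hfJ z hz α
    have hfz := hfs z (hb4δ hz)
    rw [hder hf hfs z hz, hder hf hfs z hz, hσid z hz, hJfeq (f z) hfz (hfb z (hb4δ hz)), hfJ z α,
      hK1 (f z) hfz]
  have hbJ := hCR hw (fun z hz => (hballδ z hz).1) (fun z hz => (hballδ z hz).2.1) hwJ
  have hvJ := hCR hu (fun z hz => (hballδ z hz).2.2.1) (fun z hz => (hballδ z hz).2.2.2.1) huJ
  -- `Jf² = -1` along `b`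
  have hJ2 : ∀ z ∈ ball (0 : ℂ) (δ / 4), ∀ V : (EuclideanSpace ℝ (Fin 4)), Jf (b z) (Jf (b z) V) = -V := by
    intro z hz V
    have hwz := (hballδ z (hb4δ hz)).1
    rw [hbz z hz, hJfeq (w z) hwz (hballδ z (hb4δ hz)).2.1, hJfeq (w z) hwz (hballδ z (hb4δ hz)).2.1,
      hK1 (w z) hwz, JX.map_map, map_neg, hK2 (w z) hwz]
    exact rfl
  -- `b` is immersed at `0`
  have hbinj : Injective (fderiv ℝ b 0) := by
    intro α β h
    have h' : mfderiv (𝓡 4) 𝓘(ℝ, (EuclideanSpace ℝ (Fin 4))) φ (w 0) (mfderiv 𝓘(ℝ, ℂ) (𝓡 4) w 0 α) =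
        mfderiv (𝓡 4) 𝓘(ℝ, (EuclideanSpace ℝ (Fin 4))) φ (w 0) (mfderiv 𝓘(ℝ, ℂ) (𝓡 4) w 0 β) := by
      rw [← hbder 0 (mem_ball_self hδ4), ← hbder 0 (mem_ball_self hδ4)]; exact h
    exact hwinj ((isInvertible_mfderiv_extChartAt (I := 𝓡 4) hy0).injective h')
  have hx : vf 0 = b 0 := by
    show φ (u (σ 0)) = φ (w (σ 0))
    rw [hσ0, huw]
  -- the leaf function in the chart
  set Af : (EuclideanSpace ℝ (Fin 4)) → ℂ := fun p => a (φ.symm p) with hAf_def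
  set O : Set (EuclideanSpace ℝ (Fin 4)) := φ.target ∩ φ.symm ⁻¹' N with hO_def
  have hO : IsOpen O :=
    (continuousOn_extChartAt_symm (w 0)).isOpen_inter_preimage (isOpen_extChartAt_target (w 0)) hN
  have hb0 : b 0 = φ (w 0) := by show φ (w (σ 0)) = φ (w 0); rw [hσ0]
  have hbO : b 0 ∈ O := by
    rw [hb0]
    exact ⟨mem_extChartAt_target (w 0), by
      show φ.symm (φ (w 0)) ∈ N
      rw [φ.left_inv hy0]; exact hwN⟩
  have hAf : ContDiffOn ℝ ∞ Af O :=
    contMDiffOn_iff_contDiffOn.1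
      (ha.comp ((contMDiffOn_extChartAt_symm (w 0)).mono inter_subset_left) fun p hp => hp.2)
  have hAfv : ∀ z ∈ ball (0 : ℂ) (δ / 4), Af (vf z) = a (u z) := fun z hz => by
    show a (φ.symm (φ (u (σ z)))) = a (u z)
    rw [hσid z hz, φ.left_inv (hballδ z (hb4δ hz)).2.2.1]
  have hAb : ∀ᶠ α in 𝓝 (0 : ℂ), Af (b α) = 0 := by
    obtain ⟨V, hV, W, -, -, hzeroEq⟩ := hzero
    filter_upwards [hV, ball_mem_nhds (0 : ℂ) hδ4] with α hαV hαb
    show a (φ.symm (φ (w (σ α)))) = 0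
    rw [hσid α hαb, φ.left_inv (hballδ α (hb4δ hαb)).1]
    have hmem : w α ∈ {x | x ∈ W ∧ a x = 0} := by
      rw [hzeroEq]; exact mem_image_of_mem w hαV
    exact hmem.2
  -- the differential of the leaf function at the point
  have had : MDifferentiableAt (𝓡 4) 𝓘(ℝ, ℂ) a (w 0) :=
    (ha.mdifferentiableOn (by simp)).mdifferentiableAt (hN.mem_nhds hwN)
  have hsd : MDifferentiableAt 𝓘(ℝ, (EuclideanSpace ℝ (Fin 4))) (𝓡 4) φ.symm (φ (w 0)) := by
    have h := mdifferentiableWithinAt_extChartAt_symm (I := 𝓡 4) (mem_extChartAt_target (w 0))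
    rw [hrange] at h
    exact h.mdifferentiableAt univ_mem
  have hAfder : ∀ V : (EuclideanSpace ℝ (Fin 4)), fderiv ℝ Af (φ (w 0)) V =
      mfderiv (𝓡 4) 𝓘(ℝ, ℂ) a (w 0)
        (mfderivWithin 𝓘(ℝ, (EuclideanSpace ℝ (Fin 4))) (𝓡 4) φ.symm (range (𝓡 4)) (φ (w 0)) V) := by
    intro V
    rw [← mfderiv_eq_fderiv, hrange, mfderivWithin_univ]
    have had' : MDifferentiableAt (𝓡 4) 𝓘(ℝ, ℂ) a (φ.symm (φ (w 0))) := by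
      rw [φ.left_inv hy0]; exact had
    have h := mfderiv_comp (φ (w 0)) had' hsd
    rw [φ.left_inv hy0] at h
    exact congrArg (fun T : (EuclideanSpace ℝ (Fin 4)) →L[ℝ] ℂ => T V) h
  have hAJ : ∀ V : (EuclideanSpace ℝ (Fin 4)), fderiv ℝ Af (b 0) (Jf (b 0) V) = Complex.I * fderiv ℝ Af (b 0) V := by
    intro V
    rw [hb0, hAfder, hAfder, hJfeq (w 0) hy0 (mem_ball_self hrJ), hK1 (w 0) hy0]
    exact hcl _
  have hAsurj : Surjective (fderiv ℝ Af (b 0)) := by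
    rw [hb0]
    intro c
    obtain ⟨Z, hZ⟩ := hasurj (w 0) hwN c
    refine ⟨mfderiv (𝓡 4) 𝓘(ℝ, (EuclideanSpace ℝ (Fin 4))) φ (w 0) Z, ?_⟩
    rw [hAfder, hK1 (w 0) hy0]
    exact hZ
  -- the flat core
  have h4 : Module.finrank ℝ (EuclideanSpace ℝ (Fin 4)) = 4 := finrank_euclideanSpace_fin
  rcases flat_leaf_dichotomy h4 hJf hδ4 hδ4 hb hbJ hJ2 hbinj hvf hvJ hx hO hbO hAf hAb hAJ hAsurj
    with hA | ⟨r₀, hr₀, hne0, k, hk, hwk, hkiff⟩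
  · left
    filter_upwards [hA, ball_mem_nhds (0 : ℂ) hδ4] with z hz hzb
    refine ⟨(hballδ z (hb4δ hzb)).2.2.2.2, ?_⟩
    rwa [hAfv z hzb] at hz
  · right
    set r₁ : ℝ := min r₀ (δ / 8) with hr₁_def
    have hr₁ : 0 < r₁ := lt_min hr₀ (by positivity)
    have hr₁δ : r₁ < δ / 4 := lt_of_le_of_lt (min_le_right _ _) (by linarith)
    have hnorm : ∀ (r t : ℝ), 0 < r → ‖circleLoop 0 r t‖ = r := fun r t hr => by
      simpa [abs_of_pos hr] using norm_circleLoop_sub_center 0 r t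
    have hwind_eq : ∀ r : ℝ, 0 < r → r ≤ r₁ → wind (fun t => a (u (circleLoop 0 r t))) =
        wind (fun t => Af (vf (circleLoop 0 r t))) := fun r hr hrr =>
      wind_congr fun t _ => (hAfv _ (mem_ball_zero_iff.2 (by
        rw [hnorm r t hr]; exact hrr.trans_lt hr₁δ))).symm
    refine ⟨r₁, hr₁, fun z hz hzr => ⟨(hballδ z (hb4δ (mem_ball_zero_iff.2
        (hzr.trans_lt hr₁δ)))).2.2.2.2, ?_⟩, fun r hr hrr => ?_, fun r hr hrr => ?_⟩
    · have h := hne0 z hz (hzr.trans (min_le_left _ _))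
      rwa [hAfv z (mem_ball_zero_iff.2 (hzr.trans_lt hr₁δ))] at h
    · rw [hwind_eq r hr hrr, hwk r hr (hrr.trans (min_le_left _ _))]
      exact_mod_cast hk
    · rw [hwind_eq r hr hrr, hwk r hr (hrr.trans (min_le_left _ _)), Nat.cast_eq_one, hkiff,
        mfderiv_eq_fderiv]
      have heq : (fun ζ => Af (vf ζ)) =ᶠ[𝓝 0] (a ∘ u) := by
        filter_upwards [ball_mem_nhds (0 : ℂ) hδ4] with ζ hζ
        exact hAfv ζ hζ
      rw [heq.fderiv_eq]
      exact Iff.rfl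

end Literature.Geometry.Symplectic

end
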